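/-
Copyright: the b2b-balaban T⁴-continuum CRUX team, leaf lineage `t4-ne7b-formalise-leaf-04` (gen 162). Project licence.
-/
import Summits.QuantumFields.BalabanUV.T4Continuum.Spine.NE7b.SupInductiveStep
import Summits.QuantumFields.BalabanUV.T4Continuum.Spine.NE7b.SupSmallFieldBackground
import Summits.QuantumFields.BalabanUV.T4Continuum.Spine.NE7b.LocalNemytskiiSupBall

/-!
# THE `ℓ^∞(ℤ^d)` INSTANCE OF THE SUP-CURRENCY INDUCTIVE STEP, PERTURBATION AS DATA: for the Gaussian skeleton's chart
# (`…AugmentedSupEquivalence`) and ANY `C¹` perturbation `Nu` of the field equation with letters `(λ, L)` on the sup ball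
# `‖φ‖_∞ ≤ r`, `…SupInductiveStep.inductiveStep_eq` delivers — read back in `ℓ^∞` — the background branch `σ`, the lift identity
# «`Aσ + Nu(σ)` is block-constant», its `C¹` ∕ Lipschitz letters, THE NEXT EQUATION MAP `w ↦ Q′(A(σ w) + Nu(σ w))` with `C¹` letters,
# and «zeros of the next equation lift»; the sitewise Nemytskii maps of (58) (global letters) and of `…LocalNemytskiiSupBall`
# (letters on `|t| ≤ ρ`, `r < ρ`) feed it by one `obtain` each
# (row NE7b, node U5c; SIS ∕ ASE ∕ (60) §1 ∕ (58) ∕ LNSB BY NAME; [folklore])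

Cell `pub-balaban`, sub-cell `t4`, spine estimate NE7b (`T4WeightBudget.RelWeightBound`; the cell's OWN estimate — NOT PRINTED
in [Bałaban 1983–89], NOT PROVED).  Crux-route work under `Spine/NE7b/` by leaf lineage `t4-ne7b-formalise-leaf-04` (gen 162) under
FREEZE (0)'s crux-prover clause (FILING-CLAIM C-ne7bleaf04g162-7; the object CEDED by leaf-06 g160, whose NOT-TO-FILE junction probe
`skeleton_feeds_inductiveStep` (cert 2cd2f1c1d3bfc533) is the pattern of §2's proof — credited with thanks; OWNER word
W-ne7bp1-g114-9 (c)).  NOTHING of Bałaban's is named as a Lean object, valued or asserted; no `T4Continuum/Support` leaf typed; no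
`def`, no notation; zero `sorry`.  Imports (BY NAME): leaf-06's `…SupInductiveStep` (SIS: `inductiveStep_eq`), the OWNER's (60)
`…SupSmallFieldBackground` (`exists_clm_toKer`; through it leaf-06's (57) `…AugmentedSupEquivalence` — `exists_aug_equiv_sup`,
`blockAvg_fibreProj`, `exists_clm_of_letters` — and the OWNER's (58) `…LocalNemytskiiSup` — `exists_nemytskii`,
`nontrivial_lp_infty`), and this lineage's `…LocalNemytskiiSupBall` (LNSB: `exists_nemytskii_ball`).

WHY (located).  SIS is currency-free with the chart AS HYPOTHESIS; ASE is THE chart of the free skeleton on `ℓ^∞(ℤ^d)` (every side,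
`d ≥ 3`); (58) ∕ LNSB are the Nemytskii letters of a sitewise interaction.  The junction — one screen of plumbing — is what makes
«the sup road reaches the perturbed skeleton's INDUCTIVE STEP» a tree statement rather than a probe.  The perturbation enters AS
DATA (`Nu`, `N′` with `Nu 0 = 0` and the three letters on `closedBall 0 r`), so that the global-letters map of (58), the
local-letters map of LNSB, and any later local functional feed THE SAME theorem.  Dictionary: `E = F = ℓ^∞(ℤ^d)`, `K = ker Q′`,
`Q := Q′` (`Dop`), `Lp c := c ∘ blk` (block-constant lift, §1), `P := P_K` ((60) §1: `P = 1 − Q′*Q′` read in `ker Q′`, `‖P_K‖ ≤ 2`),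
`ι := subtypeL`, `Eq := A + Nu`, `Eq′ x := A + N′ x`, `A := A` (`Aop`), `T` := ASE's chart with `‖T⁻¹‖ ≤ N` for any `N` above the
displayed `N_∞`, `B := ‖A‖ + λ`, `M₃ := L`, `C_P := 2`, smallness `2λ ≤ c < N⁻¹`.

WHAT IS PROVED ([folklore]; `ℓ^∞ := lp (fun _ : X d => ℝ) ∞`, `K₁ := (N⁻¹ − c)⁻¹`):
* §1 `exists_clm_blockLift` — the lift `Lp : ℓ^∞ →L ℓ^∞`, `(Lp c)(p) = c(blk p)`, `‖Lp‖ ≤ 1`.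
* §2 **`inductiveStep_lattice`** — `3 ≤ d`, side `n + 1`, `a > 0`; perturbation data as above; `N ≥ N_∞`, `2λ ≤ c < N⁻¹`, `0 ≤ r` ⟹
  `∃ Q′ A P Lp σ` (actions displayed; operator letters `‖Q′‖ ≤ 1`, `‖A‖ ≤ c₀·K_d(1)`, `‖P‖ ≤ 2`, `‖Lp‖ ≤ 1` — so the next
  step's `B`, `‖Q‖` are by name) with: `σ 0 = 0`; (a) on `‖w‖ ≤ (N⁻¹ − c)r`: `‖σ w‖ ≤ r`, `Q′(σ w) = w`, `P(A(σ w) + Nu(σ w)) = 0`,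
  THE LIFT IDENTITY `A(σ w) + Nu(σ w) = Lp(Q′(A(σ w) + Nu(σ w)))`; `K₁`-Lipschitz; uniqueness in the `r`-ball; (b) on
  `‖w‖ < (N⁻¹ − c)r`: differentiable, `‖Dσ‖ ≤ K₁`, `Q′ ∘ Dσ = 1`, `P((A + N′(σ w))(Dσ k)) = 0`, `‖Dσ w − Dσ w′‖ ≤ K₁²(2L)K₁‖w − w′‖`;
  (c) THE NEXT EQUATION MAP `w ↦ Q′(A(σ w) + Nu(σ w))`: value `0` at `0`, `HasFDerivAt` with derivative `Q′ ∘ (A + N′(σ w)) ∘ Dσ(w)`,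
  bound `‖Q′‖(‖A‖ + λ)K₁`, modulus `‖Q′‖(L K₁ K₁ + (‖A‖ + λ)(K₁²(2L)K₁))`; (d) ZEROS LIFT: `Q′(A(σ w) + Nu(σ w)) = 0 → A(σ w) + Nu(σ w) = 0`.
* §3 **`inductiveStep_lattice_of_nemytskii`** ((58): sitewise `u`, `u 0 = 0`, `|u′| ≤ λ`, `Lip u′ ≤ L` on `ℝ`, `r` free) and
  **`inductiveStep_lattice_of_nemytskii_ball`** (LNSB: the same letters for `|t| ≤ ρ` only, `r < ρ`): (a) + Lipschitz + uniqueness +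
  (c)'s value ∕ derivative ∕ bound + (d), with `Nu φ i = u(φ i)` displayed — one `obtain` each on §2.
* §4 toy.

HONEST (what this is NOT).  The NEXT CHART `(T⁺, N⁺)` and the numbers along a tower (leaf-06's `…SupEquationTwoSteps` displays them;
ASE at the composite side is the free candidate; (A3)); constants existential and, in the pure-sup currency, USELESS BY VALUE at small
sides (leaf-03's TCS2 ∕ TCS3: `N_∞ ≥ 2.42 ∕ 3.07` at sides 2 ∕ 3 — the currency of record is MIXED, W-ne7bp1-g113-3); nothing of
the covariant `H_k`, `G_k(U)` ((A3), NC-NE7b-α UNRULED); anything of Bałaban's.  BY-NAME EFFECT ON THE WALL: NONE.  NE7b NOT PRINTED ∕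
NOT PROVED; spine PROVED 0∕9; rung (B)+1 on a FINITE torus — NOT infinite volume, NOT the mass gap, NOT Clay.  HONEST DEPENDENCY:
continuum YM on T⁴ ⇐ BetaPertH ∧ nine spine estimates (0∕9 proved); BetaPertH ⇐ (D1) ∧ (D4) ∧ CAP+tail; G-an2-4 gates asym, D1 and
NE2∕3∕4.
-/

set_option autoImplicit false

noncomputable section

namespace Summit.QuantumFields.BalabanUV.T4Continuum.NE7b.SupInductiveStepLattice

open Set Metric
open scoped ENNReal NNReal
open Literature.MathematicalPhysics.QuantumFieldTheory.Balaban1983to89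
open B4Sect5Proof (latticeConst latticeConst_nonneg)
open B6QGQLower276 (X blk B AX c0)
open B6QGQDecay237 (deltaU deltaU_pos)
open B5Hk103ScalarZd (nbhd deltaH deltaH_pos)
open Summit.QuantumFields.BalabanUV.Beta.D1BFx.BlockColumnSupNorm (cHs cHs_nonneg)
open Summit.QuantumFields.BalabanUV.Beta.D1BFx.PointColumnSplit (cKL cG0 cSplit)
open Summit.QuantumFields.BalabanUV.Beta.D1BFx.PointColumnDecay (cFar)
open AugmentedSupEquivalence (exists_aug_equiv_sup blockAvg_fibreProj exists_clm_of_letters exists_clm_AX)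
open SupSmallFieldBackground (exists_clm_toKer)
open LocalNemytskiiSup (exists_nemytskii nontrivial_lp_infty)
open LocalNemytskiiSupBall (exists_nemytskii_ball)
open SupInductiveStep (inductiveStep_eq)

variable {d : ℕ}

/-! ## §1. The block-constant lift `Lp c := c ∘ blk` -/

/-- **THE LIFT**: `c ↦ c ∘ blk` is a bounded operator on `ℓ^∞(ℤ^d)` of norm `≤ 1`, `(Lp c)(p) = c(blk p)`. [folklore] -/
theorem exists_clm_blockLift (n : ℕ) :
    ∃ Lp : lp (fun _ : X d => ℝ) ∞ →L[ℝ] lp (fun _ : X d => ℝ) ∞,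
      (∀ (c : lp (fun _ : X d => ℝ) ∞) (p : X d), Lp c p = c (blk n p)) ∧ ‖Lp‖ ≤ 1 :=
  exists_clm_of_letters (ι := X d) (κ := X d) (fun c p => c (blk n p))
    (fun _ _ _ _ _ _ _ => rfl) (fun _ _ _ _ _ => rfl) zero_le_one (fun f R hf p => by rw [one_mul]; exact hf _)

/-! ## §2. THE INSTANCE: perturbation as data -/

set_option maxHeartbeats 400000 in -- the `ker Q′`-valued chart data (ASE's `T`, (60)'s `P_K`) put the ONE `inductiveStep_eq`
-- call at ≈ 1.2× the default budget (bisected: every `have` below elaborates within it; the call alone does not)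
/-- **THE SUP-CURRENCY INDUCTIVE STEP ON `ℓ^∞(ℤ^d)` FOR THE PERTURBED GAUSSIAN SKELETON, PERTURBATION AS DATA.**  `3 ≤ d`, side
`n + 1`, `a > 0`; a perturbation `Nu : ℓ^∞ → ℓ^∞` with `Nu 0 = 0` and, on `closedBall 0 r`, derivative family `N′` (`HasFDerivAt`),
`‖N′ x‖ ≤ λ`, `‖N′ x − N′ x′‖ ≤ L‖x − x′‖`; constants `N ≥ N_∞` (ASE's displayed chart constant), `2λ ≤ c < N⁻¹`; radius `r ≥ 0`.
Conclusion: operators `Q′`, `A`, `P`, `Lp` with their displayed actions and operator letters (`‖Q′‖ ≤ 1`, `‖A‖ ≤ c₀·K_d(1)` —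
ASE `exists_clm_AX`'s, transported by extensionality —, `‖P‖ ≤ 2`, `‖Lp‖ ≤ 1`) and a branch `σ`, with SIS's (a)–(d) read in `ℓ^∞`
(module docstring).  SIS `inductiveStep_eq` at `E = F = ℓ^∞`, `K = ker Q′`, `P := P_K` ((60) §1), `ι := subtypeL`, `T :=` ASE's chart. [folklore] -/
theorem inductiveStep_lattice (hd : 3 ≤ d) (n : ℕ) {a : ℝ} (ha : 0 < a)
    {Nu : lp (fun _ : X d => ℝ) ∞ → lp (fun _ : X d => ℝ) ∞}
    {N' : lp (fun _ : X d => ℝ) ∞ → (lp (fun _ : X d => ℝ) ∞ →L[ℝ] lp (fun _ : X d => ℝ) ∞)} (hN0 : Nu 0 = 0)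
    {r : ℝ} (hr : 0 ≤ r) (hNd : ∀ x ∈ closedBall (0 : lp (fun _ : X d => ℝ) ∞) r, HasFDerivAt Nu (N' x) x)
    {lam c N : ℝ≥0} (hNn : ∀ x ∈ closedBall (0 : lp (fun _ : X d => ℝ) ∞) r, ‖N' x‖ ≤ lam) {L : ℝ} (hL0 : 0 ≤ L)
    (hNl : ∀ x ∈ closedBall (0 : lp (fun _ : X d => ℝ) ∞) r, ∀ x' ∈ closedBall (0 : lp (fun _ : X d => ℝ) ∞) r,
      ‖N' x - N' x'‖ ≤ L * ‖x - x'‖)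
    (hN : cHs d a * latticeConst d (deltaH d a)
        + ((cG0 d * cKL d (d - 2) + cSplit d a) * Real.exp (2 * deltaU d a)
            + cFar d a * Real.exp (4 * deltaU d a) / deltaU d a ^ 2) * latticeConst d (deltaU d a / 4)
          * (1 + cHs d a * latticeConst d (deltaH d a)) ≤ (N : ℝ))
    (hc : 2 * lam ≤ c) (hcN : c < N⁻¹) :
    ∃ (Dop Aop Pop Lp : lp (fun _ : X d => ℝ) ∞ →L[ℝ] lp (fun _ : X d => ℝ) ∞)
      (σ : lp (fun _ : X d => ℝ) ∞ → lp (fun _ : X d => ℝ) ∞),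
      (∀ (f : lp (fun _ : X d => ℝ) ∞) (y : X d), Dop f y = (((n : ℝ) + 1) ^ d)⁻¹ * ∑ p ∈ B n y, f p) ∧
      (∀ (f : lp (fun _ : X d => ℝ) ∞) (p : X d), Aop f p = ∑ r ∈ nbhd n p, AX n a p r * f r) ∧
      (∀ (f : lp (fun _ : X d => ℝ) ∞) (p : X d), Pop f p = f p - (((n : ℝ) + 1) ^ d)⁻¹ * ∑ p' ∈ B n (blk n p), f p') ∧
      (∀ (f : lp (fun _ : X d => ℝ) ∞) (p : X d), Lp f p = f (blk n p)) ∧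
      (‖Dop‖ ≤ 1 ∧ ‖Aop‖ ≤ c0 d n a * latticeConst d 1 ∧ ‖Pop‖ ≤ 2 ∧ ‖Lp‖ ≤ 1) ∧
      σ 0 = 0 ∧
      -- (a) the branch on the closed chart ball, the lift identity, Lipschitz, uniqueness
      (∀ w ∈ closedBall (0 : lp (fun _ : X d => ℝ) ∞) (((N : ℝ)⁻¹ - c) * r),
        σ w ∈ closedBall (0 : lp (fun _ : X d => ℝ) ∞) r ∧ Dop (σ w) = w ∧ Pop (Aop (σ w) + Nu (σ w)) = 0 ∧
          Aop (σ w) + Nu (σ w) = Lp (Dop (Aop (σ w) + Nu (σ w)))) ∧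
      LipschitzOnWith (N⁻¹ - c)⁻¹ σ (closedBall (0 : lp (fun _ : X d => ℝ) ∞) (((N : ℝ)⁻¹ - c) * r)) ∧
      (∀ x ∈ closedBall (0 : lp (fun _ : X d => ℝ) ∞) r, Pop (Aop x + Nu x) = 0 → σ (Dop x) = x) ∧
      -- (b) the derivative letters on the open chart ball
      (∀ w ∈ ball (0 : lp (fun _ : X d => ℝ) ∞) (((N : ℝ)⁻¹ - c) * r),
        DifferentiableAt ℝ σ w ∧ ‖fderiv ℝ σ w‖ ≤ ((N : ℝ)⁻¹ - c)⁻¹ ∧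
          Dop.comp (fderiv ℝ σ w) = ContinuousLinearMap.id ℝ (lp (fun _ : X d => ℝ) ∞) ∧
          ∀ k, Pop ((Aop + N' (σ w)) (fderiv ℝ σ w k)) = 0) ∧
      (∀ w ∈ ball (0 : lp (fun _ : X d => ℝ) ∞) (((N : ℝ)⁻¹ - c) * r),
        ∀ w' ∈ ball (0 : lp (fun _ : X d => ℝ) ∞) (((N : ℝ)⁻¹ - c) * r),
          ‖fderiv ℝ σ w - fderiv ℝ σ w'‖ ≤ (((N : ℝ)⁻¹ - c)⁻¹) ^ 2 * (2 * L) * ((N : ℝ)⁻¹ - c)⁻¹ * ‖w - w'‖) ∧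
      -- (c) the next equation map `w ↦ Q′(A(σ w) + Nu(σ w))` and its `C¹` letters
      Dop (Aop (σ 0) + Nu (σ 0)) = 0 ∧
      (∀ w ∈ ball (0 : lp (fun _ : X d => ℝ) ∞) (((N : ℝ)⁻¹ - c) * r),
        HasFDerivAt (fun w => Dop (Aop (σ w) + Nu (σ w))) (Dop.comp ((Aop + N' (σ w)).comp (fderiv ℝ σ w))) w ∧
          ‖Dop.comp ((Aop + N' (σ w)).comp (fderiv ℝ σ w))‖ ≤ ‖Dop‖ * (‖Aop‖ + lam) * ((N : ℝ)⁻¹ - c)⁻¹) ∧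
      (∀ w ∈ ball (0 : lp (fun _ : X d => ℝ) ∞) (((N : ℝ)⁻¹ - c) * r),
        ∀ w' ∈ ball (0 : lp (fun _ : X d => ℝ) ∞) (((N : ℝ)⁻¹ - c) * r),
          ‖Dop.comp ((Aop + N' (σ w)).comp (fderiv ℝ σ w)) - Dop.comp ((Aop + N' (σ w')).comp (fderiv ℝ σ w'))‖ ≤
            ‖Dop‖ * (L * ((N : ℝ)⁻¹ - c)⁻¹ * ((N : ℝ)⁻¹ - c)⁻¹ +
              (‖Aop‖ + lam) * ((((N : ℝ)⁻¹ - c)⁻¹) ^ 2 * (2 * L) * ((N : ℝ)⁻¹ - c)⁻¹)) * ‖w - w'‖) ∧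
      -- (d) zeros of the next equation lift
      (∀ w ∈ closedBall (0 : lp (fun _ : X d => ℝ) ∞) (((N : ℝ)⁻¹ - c) * r),
        Dop (Aop (σ w) + Nu (σ w)) = 0 → Aop (σ w) + Nu (σ w) = 0) := by
  haveI : Nonempty (X d) := ⟨fun _ => 0⟩
  haveI : Nontrivial (lp (fun _ : X d => ℝ) ∞) := nontrivial_lp_infty
  -- ASE: the operators and the chart; `N_∞ ≤ N`
  obtain ⟨Dop, Aop, Pop, hD, hA, hP, hDn, hPn, Rop, hRapp, T, hT, -, hTN⟩ := exists_aug_equiv_sup hd n ha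
  -- `‖A‖`: ASE seals the operator behind its action; the letter is `exists_clm_AX`'s, transported by extensionality
  have hAn : ‖Aop‖ ≤ c0 d n a * latticeConst d 1 := by
    obtain ⟨A', hA', hA'n⟩ := exists_clm_AX (d := d) n ha
    have e : Aop = A' := ContinuousLinearMap.ext fun f => lp.ext (funext fun p => by rw [hA, hA'])
    rw [e]; exact hA'n
  have hTN' : ∀ y : lp (fun _ : X d => ℝ) ∞ × Dop.ker, ‖T.symm y‖ ≤ N * ‖y‖ := fun y =>
    (hTN y).trans (mul_le_mul_of_nonneg_right hN (norm_nonneg y))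
  -- the fibre projection into `ker Q′` ((60) §1) and the lift (§1)
  obtain ⟨PK, hPK, hPKnorm⟩ := exists_clm_toKer n Dop Pop (blockAvg_fibreProj hD hP) hP
  obtain ⟨Lp, hLp, hLpn⟩ := exists_clm_blockLift (d := d) n
  have hPι : ∀ h, Dop.ker.subtypeL (PK h) = h - Lp (Dop h) := fun h => by
    rw [Submodule.subtypeL_apply, hPK]
    exact lp.ext (funext fun p => by rw [hP, lp.coeFn_sub, Pi.sub_apply, hLp, hD])
  have hT' : ∀ h, T h = (Dop h, PK (Aop h)) := fun h => by
    rw [hT]; exact Prod.ext rfl (Subtype.ext (by rw [hRapp, hPK]))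
  -- `P_K f = 0` in `ker Q′` ⟺ `P f = 0` in `ℓ^∞`
  have hPK0 : ∀ f : lp (fun _ : X d => ℝ) ∞, PK f = 0 ↔ Pop f = 0 := fun f => by
    constructor
    · intro h
      have e := congrArg Subtype.val h
      rw [hPK, ZeroMemClass.coe_zero] at e
      exact e
    · intro h
      exact Subtype.ext (by rw [hPK, ZeroMemClass.coe_zero]; exact h)
  -- SIS's equation-map letters
  have hE0 : Aop 0 + Nu 0 = 0 := by rw [hN0, map_zero, add_zero]
  have hE : ∀ x ∈ closedBall (0 : lp (fun _ : X d => ℝ) ∞) r, HasFDerivAt (fun φ => Aop φ + Nu φ) (Aop + N' x) x :=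
    fun x hx => Aop.hasFDerivAt.add (hNd x hx)
  have hB : ∀ x ∈ closedBall (0 : lp (fun _ : X d => ℝ) ∞) r, ‖Aop + N' x‖ ≤ ‖Aop‖ + lam := fun x hx =>
    (norm_add_le _ _).trans (add_le_add le_rfl (hNn x hx))
  have hM : ∀ x ∈ closedBall (0 : lp (fun _ : X d => ℝ) ∞) r, ∀ x' ∈ closedBall (0 : lp (fun _ : X d => ℝ) ∞) r,
      ‖(Aop + N' x) - (Aop + N' x')‖ ≤ L * ‖x - x'‖ := fun x hx x' hx' => by
    rw [add_sub_add_left_eq_sub]; exact hNl x hx x' hx'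
  have hPK2 : ‖PK‖ ≤ (2 : ℝ) := hPKnorm
  have hc' : ∀ x ∈ closedBall (0 : lp (fun _ : X d => ℝ) ∞) r, ‖PK.comp ((Aop + N' x) - Aop)‖ ≤ c := fun x hx => by
    rw [add_sub_cancel_left]
    exact (ContinuousLinearMap.opNorm_comp_le _ _).trans
      ((mul_le_mul hPK2 (hNn x hx) (norm_nonneg _) zero_le_two).trans (by exact_mod_cast hc))
  -- SIS
  obtain ⟨σ, hσ0, ha', hlip, huniq, hb, hΛ, hc0, hcd, hcm, hzero⟩ :=
    inductiveStep_eq Dop Lp PK Dop.ker.subtypeL hPι hPK2 hE0 hr hE hB hL0 hM Aop T hT' hTN' hcN hc'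
  refine ⟨Dop, Aop, Pop, Lp, σ, hD, hA, hP, hLp, ⟨hDn, hAn, hPn, hLpn⟩, hσ0, fun w hw => ?_, hlip, fun x hx hPx => ?_,
    fun w hw => ?_, hΛ, hc0, hcd, hcm, hzero⟩
  · obtain ⟨h1, h2, h3, h4⟩ := ha' w hw
    exact ⟨h1, h2, (hPK0 _).1 h3, h4⟩
  · exact huniq x hx ((hPK0 _).2 hPx)
  · obtain ⟨h1, h2, h3, h4⟩ := hb w hw
    exact ⟨h1, h2, h3, fun k => (hPK0 _).1 (h4 k)⟩

/-! ## §3. The two sitewise feeds: (58)'s global letters, LNSB's letters on the ball -/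

/-- **THE STEP FOR A SITEWISE INTERACTION WITH GLOBAL LETTERS** ((58) `exists_nemytskii` ⟶ §2): `u` differentiable everywhere,
`u 0 = 0`, `|u′| ≤ λ`, `u′` `L`-Lipschitz on `ℝ`; `N ≥ N_∞`, `2λ ≤ c < N⁻¹`, any `r ≥ 0` ⟹ the branch with the lift identity, Lipschitz,
uniqueness, the next equation map `w ↦ Q′(A(σ w) + u∘(σ w))` (value, derivative, bound) and the lift of zeros, `Nu φ i = u(φ i)`
displayed. [folklore] -/
theorem inductiveStep_lattice_of_nemytskii (hd : 3 ≤ d) (n : ℕ) {a : ℝ} (ha : 0 < a)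
    {u u' : ℝ → ℝ} (hu : ∀ t, HasDerivAt u (u' t) t) (hu0 : u 0 = 0) {lam c N : ℝ≥0} (hlam : ∀ t, |u' t| ≤ lam)
    {L : ℝ} (hL0 : 0 ≤ L) (hL : ∀ s t, |u' s - u' t| ≤ L * |s - t|)
    (hN : cHs d a * latticeConst d (deltaH d a)
        + ((cG0 d * cKL d (d - 2) + cSplit d a) * Real.exp (2 * deltaU d a)
            + cFar d a * Real.exp (4 * deltaU d a) / deltaU d a ^ 2) * latticeConst d (deltaU d a / 4)
          * (1 + cHs d a * latticeConst d (deltaH d a)) ≤ (N : ℝ))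
    (hc : 2 * lam ≤ c) (hcN : c < N⁻¹) {r : ℝ} (hr : 0 ≤ r) :
    ∃ (Nu : lp (fun _ : X d => ℝ) ∞ → lp (fun _ : X d => ℝ) ∞)
      (N' : lp (fun _ : X d => ℝ) ∞ → (lp (fun _ : X d => ℝ) ∞ →L[ℝ] lp (fun _ : X d => ℝ) ∞))
      (Dop Aop Pop Lp : lp (fun _ : X d => ℝ) ∞ →L[ℝ] lp (fun _ : X d => ℝ) ∞)
      (σ : lp (fun _ : X d => ℝ) ∞ → lp (fun _ : X d => ℝ) ∞),
      (∀ (φ : lp (fun _ : X d => ℝ) ∞) (i : X d), Nu φ i = u (φ i)) ∧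
      (∀ (f : lp (fun _ : X d => ℝ) ∞) (y : X d), Dop f y = (((n : ℝ) + 1) ^ d)⁻¹ * ∑ p ∈ B n y, f p) ∧
      (∀ (f : lp (fun _ : X d => ℝ) ∞) (p : X d), Aop f p = ∑ r ∈ nbhd n p, AX n a p r * f r) ∧
      (∀ (f : lp (fun _ : X d => ℝ) ∞) (p : X d), Pop f p = f p - (((n : ℝ) + 1) ^ d)⁻¹ * ∑ p' ∈ B n (blk n p), f p') ∧
      (∀ (f : lp (fun _ : X d => ℝ) ∞) (p : X d), Lp f p = f (blk n p)) ∧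
      σ 0 = 0 ∧
      (∀ w ∈ closedBall (0 : lp (fun _ : X d => ℝ) ∞) (((N : ℝ)⁻¹ - c) * r),
        σ w ∈ closedBall (0 : lp (fun _ : X d => ℝ) ∞) r ∧ Dop (σ w) = w ∧ Pop (Aop (σ w) + Nu (σ w)) = 0 ∧
          Aop (σ w) + Nu (σ w) = Lp (Dop (Aop (σ w) + Nu (σ w)))) ∧
      LipschitzOnWith (N⁻¹ - c)⁻¹ σ (closedBall (0 : lp (fun _ : X d => ℝ) ∞) (((N : ℝ)⁻¹ - c) * r)) ∧
      (∀ x ∈ closedBall (0 : lp (fun _ : X d => ℝ) ∞) r, Pop (Aop x + Nu x) = 0 → σ (Dop x) = x) ∧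
      Dop (Aop (σ 0) + Nu (σ 0)) = 0 ∧
      (∀ w ∈ ball (0 : lp (fun _ : X d => ℝ) ∞) (((N : ℝ)⁻¹ - c) * r),
        HasFDerivAt (fun w => Dop (Aop (σ w) + Nu (σ w))) (Dop.comp ((Aop + N' (σ w)).comp (fderiv ℝ σ w))) w ∧
          ‖Dop.comp ((Aop + N' (σ w)).comp (fderiv ℝ σ w))‖ ≤ ‖Dop‖ * (‖Aop‖ + lam) * ((N : ℝ)⁻¹ - c)⁻¹) ∧
      (∀ w ∈ closedBall (0 : lp (fun _ : X d => ℝ) ∞) (((N : ℝ)⁻¹ - c) * r),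
        Dop (Aop (σ w) + Nu (σ w)) = 0 → Aop (σ w) + Nu (σ w) = 0) := by
  obtain ⟨Nu, N', hNapp, -, hNderiv, hN'norm, hN'lip⟩ := exists_nemytskii (ι := X d) hu lam.coe_nonneg hlam hL0 hL
  have hN0 : Nu 0 = 0 := lp.ext (funext fun i => by rw [hNapp, lp.coeFn_zero, Pi.zero_apply, hu0])
  obtain ⟨Dop, Aop, Pop, Lp, σ, hD, hA, hP, hLp, -, hσ0, ha', hlip, huniq, -, -, hc0, hcd, -, hzero⟩ :=
    inductiveStep_lattice hd n ha hN0 hr (fun x _ => hNderiv x) (fun x _ => hN'norm x) hL0 (fun x _ x' _ => hN'lip x x')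
      hN hc hcN
  exact ⟨Nu, N', Dop, Aop, Pop, Lp, σ, hNapp, hD, hA, hP, hLp, hσ0, ha', hlip, huniq, hc0, hcd, hzero⟩

/-- **THE STEP FOR A SITEWISE INTERACTION WITH LETTERS ON THE SUP BALL ONLY** (LNSB `exists_nemytskii_ball` ⟶ §2): `u`
differentiable everywhere, `u 0 = 0`, `|u′ t| ≤ λ` and `|u′ s − u′ t| ≤ L|s − t|` for `|s|, |t| ≤ ρ` ONLY; `N ≥ N_∞`, `2λ ≤ c < N⁻¹`,
radius `0 ≤ r < ρ` ⟹ the same conclusions — the small-field letter read on the sup ball, as print's small-field regions are.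
[folklore] -/
theorem inductiveStep_lattice_of_nemytskii_ball (hd : 3 ≤ d) (n : ℕ) {a : ℝ} (ha : 0 < a)
    {u u' : ℝ → ℝ} (hu : ∀ t, HasDerivAt u (u' t) t) (hu0 : u 0 = 0) {ρ : ℝ} {lam c N : ℝ≥0}
    (hlam : ∀ t, |t| ≤ ρ → |u' t| ≤ lam) {L : ℝ} (hL0 : 0 ≤ L)
    (hL : ∀ s t, |s| ≤ ρ → |t| ≤ ρ → |u' s - u' t| ≤ L * |s - t|)
    (hN : cHs d a * latticeConst d (deltaH d a)
        + ((cG0 d * cKL d (d - 2) + cSplit d a) * Real.exp (2 * deltaU d a)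
            + cFar d a * Real.exp (4 * deltaU d a) / deltaU d a ^ 2) * latticeConst d (deltaU d a / 4)
          * (1 + cHs d a * latticeConst d (deltaH d a)) ≤ (N : ℝ))
    (hc : 2 * lam ≤ c) (hcN : c < N⁻¹) {r : ℝ} (hr : 0 ≤ r) (hrρ : r < ρ) :
    ∃ (Nu : lp (fun _ : X d => ℝ) ∞ → lp (fun _ : X d => ℝ) ∞)
      (N' : lp (fun _ : X d => ℝ) ∞ → (lp (fun _ : X d => ℝ) ∞ →L[ℝ] lp (fun _ : X d => ℝ) ∞))
      (Dop Aop Pop Lp : lp (fun _ : X d => ℝ) ∞ →L[ℝ] lp (fun _ : X d => ℝ) ∞)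
      (σ : lp (fun _ : X d => ℝ) ∞ → lp (fun _ : X d => ℝ) ∞),
      (∀ (φ : lp (fun _ : X d => ℝ) ∞) (i : X d), Nu φ i = u (φ i)) ∧
      (∀ (f : lp (fun _ : X d => ℝ) ∞) (y : X d), Dop f y = (((n : ℝ) + 1) ^ d)⁻¹ * ∑ p ∈ B n y, f p) ∧
      (∀ (f : lp (fun _ : X d => ℝ) ∞) (p : X d), Aop f p = ∑ r ∈ nbhd n p, AX n a p r * f r) ∧
      (∀ (f : lp (fun _ : X d => ℝ) ∞) (p : X d), Pop f p = f p - (((n : ℝ) + 1) ^ d)⁻¹ * ∑ p' ∈ B n (blk n p), f p') ∧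
      (∀ (f : lp (fun _ : X d => ℝ) ∞) (p : X d), Lp f p = f (blk n p)) ∧
      σ 0 = 0 ∧
      (∀ w ∈ closedBall (0 : lp (fun _ : X d => ℝ) ∞) (((N : ℝ)⁻¹ - c) * r),
        σ w ∈ closedBall (0 : lp (fun _ : X d => ℝ) ∞) r ∧ Dop (σ w) = w ∧ Pop (Aop (σ w) + Nu (σ w)) = 0 ∧
          Aop (σ w) + Nu (σ w) = Lp (Dop (Aop (σ w) + Nu (σ w)))) ∧
      LipschitzOnWith (N⁻¹ - c)⁻¹ σ (closedBall (0 : lp (fun _ : X d => ℝ) ∞) (((N : ℝ)⁻¹ - c) * r)) ∧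
      (∀ x ∈ closedBall (0 : lp (fun _ : X d => ℝ) ∞) r, Pop (Aop x + Nu x) = 0 → σ (Dop x) = x) ∧
      Dop (Aop (σ 0) + Nu (σ 0)) = 0 ∧
      (∀ w ∈ ball (0 : lp (fun _ : X d => ℝ) ∞) (((N : ℝ)⁻¹ - c) * r),
        HasFDerivAt (fun w => Dop (Aop (σ w) + Nu (σ w))) (Dop.comp ((Aop + N' (σ w)).comp (fderiv ℝ σ w))) w ∧
          ‖Dop.comp ((Aop + N' (σ w)).comp (fderiv ℝ σ w))‖ ≤ ‖Dop‖ * (‖Aop‖ + lam) * ((N : ℝ)⁻¹ - c)⁻¹) ∧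
      (∀ w ∈ closedBall (0 : lp (fun _ : X d => ℝ) ∞) (((N : ℝ)⁻¹ - c) * r),
        Dop (Aop (σ w) + Nu (σ w)) = 0 → Aop (σ w) + Nu (σ w) = 0) := by
  obtain ⟨Nu, N', hNapp, -, hN'norm, hNderiv, hN'lip⟩ :=
    exists_nemytskii_ball (ι := X d) hu lam.coe_nonneg hlam hL0 hL
  have hsub : closedBall (0 : lp (fun _ : X d => ℝ) ∞) r ⊆ ball (0 : lp (fun _ : X d => ℝ) ∞) ρ :=
    closedBall_subset_ball hrρ
  have hsub' : closedBall (0 : lp (fun _ : X d => ℝ) ∞) r ⊆ closedBall (0 : lp (fun _ : X d => ℝ) ∞) ρ :=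
    closedBall_subset_closedBall hrρ.le
  have hN0 : Nu 0 = 0 := lp.ext (funext fun i => by rw [hNapp, lp.coeFn_zero, Pi.zero_apply, hu0])
  obtain ⟨Dop, Aop, Pop, Lp, σ, hD, hA, hP, hLp, -, hσ0, ha', hlip, huniq, -, -, hc0, hcd, -, hzero⟩ :=
    inductiveStep_lattice hd n ha hN0 hr (fun x hx => hNderiv x (hsub hx)) (fun x hx => hN'norm x (hsub' hx)) hL0
      (fun x hx x' hx' => hN'lip x (hsub' hx) x' (hsub' hx')) hN hc hcN
  exact ⟨Nu, N', Dop, Aop, Pop, Lp, σ, hNapp, hD, hA, hP, hLp, hσ0, ha', hlip, huniq, hc0, hcd, hzero⟩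

/-! ## §4. Toy -/

/-- Toy: the instance's smallness bookkeeping — `C_P = 2`, so `λ = 1∕20`, `N = 4` give `c := 2λ = 1∕10 < N⁻¹ = 1∕4` and
`K₁ = (N⁻¹ − c)⁻¹ = 20∕3`. -/
example : (2 : ℝ) * (1 / 20) < (4 : ℝ)⁻¹ ∧ ((4 : ℝ)⁻¹ - 2 * (1 / 20))⁻¹ = 20 / 3 := by norm_num

end Summit.QuantumFields.BalabanUV.T4Continuum.NE7b.SupInductiveStepLattice

end
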